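import Mathlib.Order.PiLex
import Mathlib.MeasureTheory.VectorMeasure.WithDensity
import Literature.MathematicalPhysics.QuantumLattice.BalabanRG
import Literature.MathematicalPhysics.QuantumLattice.WilsonFermionBlockAveraging
import HarnessLib

/-!
# Block renormalisation group for lattice gauge fields coupled to Wilson–Dirac fermions

Topic `Literature/MathematicalPhysics/QuantumLattice`; definition request `defn-BlockFermionRG`
(route `QuantumFields/QCD/BanksZaksTestbed`, items `BanksZaksContinuum`/`WindowFiniteVolumeLimit`:
the vocabulary needed to STATE a bounded-coupling block RG flow `(g_j, m_j, D_j)` for `SU(3)` with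
`N_f` Wilson flavours). It couples the two existing halves of the tree:

* the pure-gauge block RG on `ℤ^d` of `BalabanRG` (`blockMap`, `blockBase`, `blockSites`,
  `axialBlockHolonomy` = Bałaban's gauge-field block average `Ū`, `freeHaarConfig`,
  `IsBlockRGStepOf`, `BlockRGScheme`, `InWindow`), and
* the fermionic block RG at FIXED gauge field of `WilsonFermionBlockAveraging` (the generic
  Bałaban–O'Carroll–Schor transformation `fermionBlockRG R a Q Q̄ : Λ(ψ̄,ψ) →ₗ Λ(χ̄,χ)`, its
  Gaussian closure `fermionBlockRG_grassmannExp_quadratic`, `fluctuationOp`, `blockDirac`; there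
  the covariant averaging `fermionBlockAvg` lives on the discrete TORUS),

into Dimock's coupled transformation for a DYNAMICAL gauge field, on `ℤ^d` (where `Ū` lives).

## Content

* **Block paths and transporters on `ℤ^d`.** `straightSegment`, `taxiPathAux` / `taxiPath x t`
  (the fixed contour from `x` to `x + t`, coordinate directions in increasing order — the `ℤ^d`
  twin of the torus `pathEdges`/`torusBlockPath`), `pathTransport U l` (ordered product of link
  variables; `axialBlockHolonomy_eq_pathTransport`), `blockOffset M x`
  (`x = M⌊x/M⌋ + blockOffset`, `blockBase_blockMap_add_blockOffset`) and the transporter from the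
  block corner `blockCornerTransport M U x = U(Γ_{M⌊x/M⌋, x})`, with gauge covariance
  `pathTransport_taxiPath_gaugeTransformZd`, `blockCornerTransport_gaugeTransformZd` (telescoping,
  from `BalabanRG.prod_range_map_mul_mul_inv`).
* **The gauge-covariant fermion block average on `ℤ^d`** `fermionBlockAvgZd ρ M U` — the matrix
  `Q(U)` on `site × colour × internal` (internal = spin × flavour, acted on trivially),
  `(Q(U)ψ)(y) = M^{-d} Σ_{x ∈ B(y)} ρ(U(Γ_{My,x})) ψ(x)` — and its conjugate `fermionBlockAvgBarZd`
  (`Q̄(U)`, on `ψ̄`, with `ρ(U(Γ)⁻¹)`): the `ℤ^d` twins of `fermionBlockAvg`/`fermionBlockAvgBar`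
  (same formula and conventions: corners `M y`, weight `M^{-d}`, inverse transporter for `ψ̄`);
  `M = 1` is the identity (`fermionBlockAvgZd_one_left`); gauge covariance colour-blockwise
  (`fermionBlockAvgZd_gaugeTransformZd`). Sources: Bałaban–O'Carroll–Schor, CMP 122 (1989) 233,
  (1.1); Dimock, J. Math. Phys. 63 (2022) 042305, §2: `(Q(A)Ψ)(y) = L^{-3} Σ_{x∈B(y)}
  e^{ieA(Γ(y,x))} Ψ(x)`; Bałaban CMP 95 (1984) §1, CMP 98 (1985) §1.
* **Finite volumes and ordered fermion indices.** `fineSites M Λ` (union of the blocks over `Λ`),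
  `siteEdges Λ = Λ × Fin d` (edges emanating from `Λ`; `fineEdges_siteEdges`: the volumes are
  self-similar under blocking), `VolSite Λ` (sites of `Λ` in the lexicographic order of `ℤ^d`,
  Mathlib `Pi.Lex`), `FermiIdx Λ N σ = VolSite Λ ×ₗ (Fin N ×ₗ σ)` (a finite LINEAR order, as
  Berezin integration requires; the torus file enumerates by `Fintype.equivFin` instead),
  `FermiIdx.toIdx` (injective), the finite matrices `fermionBlockAvgOn`, `fermionBlockAvgBarOn`
  between the fine volume `fineSites M Λ` and `Λ`, and BOS's normalisation `blockRGNorm`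
  (`N⁻¹ = ε(-a)^n`, (1.2); not included in `fermionBlockRG`).
* **The coupled step.** `FermiAlgebra σ Λ` (complex Grassmann algebra of the volume),
  `blockFermionRGT ρ a M Λ U = fermionBlockRG ℂ a Q(U) Q̄(U)` between the fermion algebras of
  `fineSites M Λ` and `Λ` with its exact Gaussian step `blockFermionRGT_grassmannExp_quadratic`,
  and `IsBlockFermionRGStepOf ρ a M Λ ρk ρk1` — Dimock's transformation
  `ρ_{k+1}(V, χ̄, χ) = ∫ δ(V⁻¹Ū) [T_{a,Q(U)} ρ_k(U)](χ̄, χ) dU` (J. Math. Phys. 63 (2022) §2 (4)–(6),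
  there abelian, `d = 3`) with Bałaban's `Ū = axialBlockHolonomy M U`, stated coefficientwise in
  the monomial basis through `Measure.withDensityᵥ` / `VectorMeasure.map` against the free Haar
  reference measures `freeHaarConfig` of `BalabanRG` (whose `IsBlockRGStepOf` is the fermion-free
  case with positive scalar densities).
* **Wilson fermions and the scheme.** The Wilson–Dirac operator on `ℤ^d` with `N_f` flavours and
  a Dirac-matrix family `γ`, `wilsonDiracZd γ ρ U m r` (the formula of the tree's torus
  `wilsonDirac`), its volume restriction `wilsonDiracOn`, and the hypothesis structure
  `BlockFermionRGScheme d N G s N_f γ`: block size `M ≥ 2`, representation `ρ`, BOS parameter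
  `a > 0`, Wilson `r > 0`, flavour-blind bare mass, running couplings `g_k` / masses `m_k` /
  fermionic kernels `D_k(Λ; V)`, and effective densities `density k Λ V ∈ FermiAlgebra`, with
  `density 0 Λ U = e^{-g₀⁻² S_Λ(U)} e^{-ψ̄ D_W(U; m₀, r) ψ}` and `kernel 0 = D_W`; the recursion is the
  predicate `BlockFermionRGScheme.SatisfiesRecursion`, the window condition `HasBoundedFlow`.

## Design choices

* Lattice: `ℤ^d` with `Mℤ^d ≃ ℤ^d` via `blockMap`, corners `M y` as block representatives, no field
  rescaling, free boundary condition — all as in `BalabanRG`, whose gauge average `Ū` the coupled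
  step must use; this is why the covariant fermion average is re-instantiated on `ℤ^d` rather than
  imported from the torus file (same formula; the generic Grassmann layer IS imported). BOS's
  prefactor `a(Lε)⁻¹` and Riemann weights are absorbed into `a`, fixed per step (Dimock likewise
  uses a fixed `b/L` after rescaling to the unit lattice).
* `BlockFermionRGScheme` does not literally `extend BlockRGScheme`: with dynamical fermions the
  effective density is ONE Grassmann-valued function of the gauge field (its degree-zero part is
  not the pure-gauge density), so the field `effDensity` would be spurious; the shared fields
  (`M`, `two_le_M`, `ρ`, `couplings`) keep their names and `InWindow` is reused. As there, the
  recursion is a predicate rather than a field, and couplings/masses/kernels for `k ≥ 1` are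
  bookkeeping data whose extraction (localisation of the marginal/relevant terms) belongs to a
  multiscale analysis, not to this definition.
* Grassmann-valued densities are compared coefficientwise (`grassmannBasis.coord`): the Grassmann
  algebra carries no norm in Mathlib, so Bochner integrals of algebra-valued functions are not
  available; complex coefficients go through `withDensityᵥ` (`withDensity ∘ ENNReal.ofReal`, used
  for the positive pure-gauge densities, would truncate signs).
* The Dirac matrices `γ : Fin d → Matrix (Fin s) (Fin s) ℂ` are a PARAMETER of the scheme (for
  `d = 4` take `GrassmannIntegral.euclideanGamma`), so that an existential statement over schemes
  cannot choose them; BOS (1.4) is stated for general `d` with `{γ_μ, γ_ν} = 2δ_{μν}`.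
* Junk values: `blockMap`/`blockOffset` for `M = 0`; `withDensityᵥ` of a non-integrable
  coefficient is `0`; neither is met by a scheme (`2 ≤ M`; integrability is part of any use).

## What is NOT here

The small-field/large-field decomposition and the `R` operation (Bałaban CMP 109, 116, 122), the
composite averaging operators `Q_k` and BOS's composition law (1.3), the `δ`-function RGT of BOS
§II, the exponential decay of `Γ_k`, `D_k` (BOS §III), Dimock's norms and stability theorem, and a
torus version of the coupled step — statements ABOUT schemes, to be vendored as named facts or
filed as route items when needed.

## Mathlib status

Mathlib (pinned) has no lattice gauge theory, block averaging or renormalisation group and no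
Berezin integral (cf. `BalabanRG`, `GrassmannIntegral`). Used verbatim: `Pi.Lex`, `Prod.Lex`,
`Finset` subtypes, `Matrix.submatrix`, `Measure.withDensityᵥ`, `VectorMeasure.map`,
`Module.Basis.coord`; from the tree: `BalabanRG`, `LatticeGaugeDLR` (`LGConfig`, `gaugeTransformZd`,
`wilsonBoundaryAction`), `GrassmannIntegral` (`GrassmannAlgebra`, `grassmannExp`, `quadratic`,
`grassmannBasis`), `WilsonFermionBlockAveraging` (`fermionBlockRG`, `fluctuationOp`, `blockDirac`,
`fermionBlockRG_grassmannExp_quadratic`).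

## References

* T. Bałaban, M. O'Carroll, R. Schor, *Block renormalization group for Euclidean fermions*,
  CMP 122 (1989) 233–247: (1.1) (the RGT `T_{a,L}`), (1.2) (normalisation), (1.3), (1.4) (lattice
  Dirac operator), (1.5)–(1.8), Lemma II.1–II.3, (2.3) (pp. 234–237 of the held copy
  `paper:doi-10-1007-bf01257414`). Bib key `BalabanOcarrollSchor1989`.
* J. Dimock, *Stability for QED in d = 3: an overview*, J. Math. Phys. 63 (2022) 042305,
  arXiv:2204.07201, §2: the averaging operator `Q(A)` for fermions, the coupled block-averaging
  transformation (4) `ρ̃₁(A₁,Ψ₁) = N₀ ∫ DA₀ DΨ₀ δ(A₁ - QA₀) δ_ax(A₀)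
  exp(-b/L⟨Ψ̄₁ - Q(-A₀)Ψ̄₀, Ψ₁ - Q(A₀)Ψ₀⟩) ρ₀(A₀,Ψ₀)`, the sequence `ρ₀, ρ₁, …` (5)–(6) (held copy
  `paper:arxiv-2204.07201`, pp. 3–4). Bib key `Dimock2022QED3`.
* T. Bałaban, CMP 95 (1984) 17 §1, CMP 98 (1985) 17 §1 (averaging operations); CMP 109 (1987) 249
  (0.1)–(0.3) (the gauge-field RG recursion). Bib key `Balaban1987RG1`.
* K. G. Wilson (Erice 1975) (Wilson fermions); I. Montvay, G. Münster, *Quantum Fields on a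
  Lattice* (1994) §4.2.2 (4.85), §5.1.1 (5.5). Bib key `Wilson1975`.
-/

noncomputable section

open MeasureTheory Finset
open Literature.Probability.LatticeModels

namespace Literature.MathematicalPhysics.QuantumLattice

variable {d N : ℕ} {G : Type*}

/-! ### Lattice paths inside blocks and parallel transport -/

/-- The straight lattice path of `n` positively oriented edges from `x` in direction `i`:
`(x, i), (x + eᵢ, i), …, (x + (n-1) eᵢ, i)`, from `x` to `x + n eᵢ` (Bałaban CMP 95 (1984) §1,
the contours `Γ`; `blockLine M b` is the case `x = M y`, `n = M`). [folklore] -/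
def straightSegment (x : Site d) (i : Fin d) (n : ℕ) : List (ZdEdge d) :=
  (List.range n).map fun s : ℕ => (x + Pi.single i (s : ℤ), i)

/-- A straight segment of `n` steps has `n` edges. [folklore] -/
@[simp] theorem length_straightSegment (x : Site d) (i : Fin d) (n : ℕ) :
    (straightSegment x i n).length = n := by
  simp [straightSegment]

/-- Bałaban's block line is the straight segment of `M` steps from the block corner. [folklore] -/
theorem blockLine_eq_straightSegment (M : ℕ) (b : ZdEdge d) :
    blockLine M b = straightSegment (blockBase M b.1) b.2 M := rfl

/-- The "taxi" lattice path from `x` with non-negative offset vector `t`, taking the directions in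
the order of the list `is`: first `t i₁` steps in direction `i₁`, then `t i₂` steps in direction
`i₂`, … (a fixed contour inside a block from its corner to the site `x + t`, as used to define
gauge-covariant block averages: Bałaban CMP 95 (1984) §1; Dimock, J. Math. Phys. 63 (2022) §2,
"`Γ(y, x)` is a path from `x` to `y`"). [folklore] -/
def taxiPathAux (t : Fin d → ℕ) : Site d → List (Fin d) → List (ZdEdge d)
  | _, [] => []
  | x, i :: is => straightSegment x i (t i) ++ taxiPathAux t (x + Pi.single i (t i : ℤ)) is

/-- The taxi path from `x` to `x + t` taking the coordinate directions in increasing order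
`0, 1, …, d - 1`. [folklore] -/
def taxiPath (x : Site d) (t : Fin d → ℕ) : List (ZdEdge d) :=
  taxiPathAux t x (List.finRange d)

/-- With zero offsets the taxi path is empty. [folklore] -/
theorem taxiPathAux_zero (x : Site d) (is : List (Fin d)) : taxiPathAux (fun _ => 0) x is = [] := by
  induction is generalizing x with
  | nil => rfl
  | cons i is ih => simp [taxiPathAux, straightSegment, ih]

/-- With zero offsets the taxi path is empty. [folklore] -/
@[simp] theorem taxiPath_zero (x : Site d) : taxiPath x (fun _ => 0) = [] :=
  taxiPathAux_zero x _

section Transport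

variable [Monoid G]

/-- Parallel transport along a list of positively oriented edges: the ordered product
`U(e₁) U(e₂) ⋯ U(eₙ)` (Seiler LNP 159 Ch. 1; Bałaban CMP 95 (1984) (1.5)). [folklore] -/
def pathTransport (U : LGConfig d G) (l : List (ZdEdge d)) : G := (l.map U).prod

/-- Transport along the empty path is trivial. [folklore] -/
@[simp] theorem pathTransport_nil (U : LGConfig d G) : pathTransport U [] = 1 := rfl

/-- Transport is multiplicative under concatenation of paths. [folklore] -/
theorem pathTransport_append (U : LGConfig d G) (l l' : List (ZdEdge d)) :
    pathTransport U (l ++ l') = pathTransport U l * pathTransport U l' := by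
  simp [pathTransport, List.prod_append]

/-- Transport of the trivial configuration is trivial. [folklore] -/
@[simp] theorem pathTransport_one (l : List (ZdEdge d)) : pathTransport (1 : LGConfig d G) l = 1 := by
  induction l with
  | nil => rfl
  | cons e l ih => simpa [pathTransport] using ih

/-- Bałaban's axial-gauge block link variable is the transport along the block line. [folklore] -/
theorem axialBlockHolonomy_eq_pathTransport (M : ℕ) (U : LGConfig d G) (b : ZdEdge d) :
    axialBlockHolonomy M U b = pathTransport U (blockLine M b) := rfl

end Transport

section Covariance

variable [Group G]

/-- Gauge covariance of straight transports (telescoping):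
`T_{x → x+n eᵢ}(U^g) = g(x) T(U) g(x + n eᵢ)⁻¹` (Bałaban CMP 95 (1984) (1.7); from
`prod_range_map_mul_mul_inv`). [folklore] -/
theorem pathTransport_straightSegment_gaugeTransformZd (g : Site d → G) (U : LGConfig d G)
    (x : Site d) (i : Fin d) (n : ℕ) :
    pathTransport (gaugeTransformZd g U) (straightSegment x i n) =
      g x * pathTransport U (straightSegment x i n) * (g (x + Pi.single i (n : ℤ)))⁻¹ := by
  have hstep : ∀ t : ℕ, x + Pi.single i (t : ℤ) + Pi.single i 1 =
      x + Pi.single i ((t + 1 : ℕ) : ℤ) := fun t => by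
    rw [add_assoc, ← Pi.single_add, Nat.cast_succ]
  have hL : (straightSegment x i n).map (gaugeTransformZd g U) =
      (List.range n).map fun t : ℕ => g (x + Pi.single i (t : ℤ)) *
        U (x + Pi.single i (t : ℤ), i) * (g (x + Pi.single i ((t + 1 : ℕ) : ℤ)))⁻¹ := by
    rw [straightSegment, List.map_map]
    exact List.map_congr_left fun t _ => by rw [Function.comp_apply, gaugeTransformZd, hstep]
  have hR : (straightSegment x i n).map U =
      (List.range n).map fun t : ℕ => U (x + Pi.single i (t : ℤ), i) := by
    rw [straightSegment, List.map_map]; rfl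
  have key : ((List.range n).map fun t : ℕ => g (x + Pi.single i (t : ℤ)) *
        U (x + Pi.single i (t : ℤ), i) * (g (x + Pi.single i ((t + 1 : ℕ) : ℤ)))⁻¹).prod =
      g (x + Pi.single i ((0 : ℕ) : ℤ)) *
        ((List.range n).map fun t : ℕ => U (x + Pi.single i (t : ℤ), i)).prod *
          (g (x + Pi.single i (n : ℤ)))⁻¹ :=
    prod_range_map_mul_mul_inv (fun t : ℕ => g (x + Pi.single i (t : ℤ)))
      (fun t : ℕ => U (x + Pi.single i (t : ℤ), i)) n
  rw [pathTransport, pathTransport, hL, hR, key, Nat.cast_zero, Pi.single_zero, add_zero]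

/-- Gauge covariance of taxi transports (induction on the list of directions). [folklore] -/
theorem pathTransport_taxiPathAux_gaugeTransformZd (g : Site d → G) (U : LGConfig d G)
    (t : Fin d → ℕ) : ∀ (is : List (Fin d)) (x : Site d),
    pathTransport (gaugeTransformZd g U) (taxiPathAux t x is) =
      g x * pathTransport U (taxiPathAux t x is) *
        (g (x + (is.map fun i => (Pi.single i (t i : ℤ) : Site d)).sum))⁻¹
  | [], x => by simp [taxiPathAux]
  | i :: is, x => by
    rw [taxiPathAux, pathTransport_append, pathTransport_append,
      pathTransport_straightSegment_gaugeTransformZd,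
      pathTransport_taxiPathAux_gaugeTransformZd g U t is, List.map_cons, List.sum_cons, ← add_assoc]
    group

/-- **Gauge covariance of the taxi transport**: `T_{x → x+t}(U^g) = g(x) T_{x → x+t}(U) g(x+t)⁻¹`
(Bałaban CMP 95 (1984) (1.7); Dimock 2022 §2, "parallel translate … so that gauge covariance is
preserved"). [folklore] -/
theorem pathTransport_taxiPath_gaugeTransformZd (g : Site d → G) (U : LGConfig d G) (x : Site d)
    (t : Fin d → ℕ) :
    pathTransport (gaugeTransformZd g U) (taxiPath x t) =
      g x * pathTransport U (taxiPath x t) * (g (x + fun i => (t i : ℤ)))⁻¹ := by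
  rw [taxiPath, pathTransport_taxiPathAux_gaugeTransformZd, ← Fin.sum_univ_def,
    Finset.univ_sum_single]

end Covariance

/-! ### Block offsets and the block transporter -/

/-- The offset of the site `x` inside its block of side `M`: `(x i mod M) ∈ {0, …, M-1}`
coordinatewise, so that `x = M ⌊x / M⌋ + blockOffset M x` (Bałaban CMP 95 (1984) §1). For
`M = 0` this is the junk value `(x i).toNat`. [folklore] -/
def blockOffset (M : ℕ) (x : Site d) : Fin d → ℕ := fun i => (x i % (M : ℤ)).toNat

/-- Block offsets are `< M`. [folklore] -/
theorem blockOffset_lt (M : ℕ) [NeZero M] (x : Site d) (i : Fin d) : blockOffset M x i < M := by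
  have hM : (0 : ℤ) < M := by exact_mod_cast Nat.pos_of_ne_zero (NeZero.ne M)
  have h1 := Int.emod_lt_of_pos (x i) hM
  have h0 := Int.emod_nonneg (x i) hM.ne'
  simp only [blockOffset]
  omega

/-- With block size `1` all offsets vanish. [folklore] -/
@[simp] theorem blockOffset_one (x : Site d) : blockOffset 1 x = fun _ => 0 := by
  funext i; simp [blockOffset]

/-- `x = M ⌊x / M⌋ + (x mod M)`: the block corner plus the offset recovers the site. [folklore] -/
theorem blockBase_blockMap_add_blockOffset (M : ℕ) [NeZero M] (x : Site d) :
    (blockBase M (blockMap M x) + fun i => (blockOffset M x i : ℤ)) = x := by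
  have hM : (0 : ℤ) < M := by exact_mod_cast Nat.pos_of_ne_zero (NeZero.ne M)
  funext i
  simp only [Pi.add_apply, blockBase, blockMap, blockOffset,
    Int.toNat_of_nonneg (Int.emod_nonneg (x i) hM.ne')]
  exact Int.mul_ediv_add_emod (x i) M

section BlockTransporter

variable [Monoid G]

/-- The **block transporter** of the site `x`: parallel transport `U(Γ_{M y, x})` along the taxi
path from the corner `M y` of the block containing `x` (`y = ⌊x / M⌋`) to `x`
(Bałaban CMP 95 (1984) §1; Dimock, J. Math. Phys. 63 (2022) 042305, §2: the factor
`e^{i e A(Γ(y, x))}` of the fermion averaging operator, here for a general gauge group and with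
block corners instead of centres, as in `BalabanRG`; the `ℤ^d` twin of the torus `blockTransporter`
of `WilsonFermionBlockAveraging`). [folklore] -/
def blockCornerTransport (M : ℕ) (U : LGConfig d G) (x : Site d) : G :=
  pathTransport U (taxiPath (blockBase M (blockMap M x)) (blockOffset M x))

/-- Without blocking (`M = 1`) the block transporter is trivial. [folklore] -/
@[simp] theorem blockCornerTransport_one_left (U : LGConfig d G) (x : Site d) :
    blockCornerTransport 1 U x = 1 := by
  simp [blockCornerTransport]

/-- The block transporter of the trivial configuration is trivial. [folklore] -/
@[simp] theorem blockCornerTransport_one (M : ℕ) (x : Site d) :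
    blockCornerTransport M (1 : LGConfig d G) x = 1 := by
  simp [blockCornerTransport]

end BlockTransporter

/-- **Gauge covariance of the block transporter**:
`T_x(U^g) = g(M y) T_x(U) g(x)⁻¹`, `y = ⌊x / M⌋` (Bałaban CMP 95 (1984) (1.7)). [folklore] -/
theorem blockCornerTransport_gaugeTransformZd [Group G] (M : ℕ) [NeZero M] (g : Site d → G)
    (U : LGConfig d G) (x : Site d) :
    blockCornerTransport M (gaugeTransformZd g U) x =
      g (blockBase M (blockMap M x)) * blockCornerTransport M U x * (g x)⁻¹ := by
  rw [blockCornerTransport, blockCornerTransport, pathTransport_taxiPath_gaugeTransformZd,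
    blockBase_blockMap_add_blockOffset]

/-! ### The gauge-covariant fermion block average `Q(U)` -/

section Average

variable [Group G] (ρ : G →* Matrix (Fin N) (Fin N) ℂ) {σ : Type*} [DecidableEq σ]

/-- The **gauge-covariant block averaging operator for fermions** `Q(U)`, as a matrix on the
index `site × colour × internal` of `ℤ^d` (internal = spin × flavour, acted on trivially):
`Q(U)_{(y,a,s),(x,b,s')} = M^{-d} δ_{s s'} [⌊x/M⌋ = y] ρ(U(Γ_{My,x}))_{ab}`, i.e.
`(Q(U)ψ)(y) = M^{-d} Σ_{x ∈ B(y)} ρ(U(Γ_{My,x})) ψ(x)` — the arithmetic block average after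
parallel transport to the block corner along the fixed block paths (Bałaban–O'Carroll–Schor,
CMP 122 (1989) 233, (1.1): `Q` "the arithmetic averaging operator over a block"; gauge-covariant
form: Dimock, J. Math. Phys. 63 (2022) 042305, §2, `(Q(A)Ψ)(y) = L^{-3} Σ_{x ∈ B(y)}
e^{ieA(Γ(y,x))} Ψ(x)`; Bałaban CMP 95 (1984) §1 for the gauge-field analogue). The coarse
lattice `M ℤ^d` is identified with `ℤ^d` through `blockMap`, as in `BalabanRG`; this is the `ℤ^d`
twin of the torus operator `fermionBlockAvg` of `WilsonFermionBlockAveraging` (same formula and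
conventions). [cite: BalabanOcarrollSchor1989, (1.1)] -/
def fermionBlockAvgZd (M : ℕ) (U : LGConfig d G) :
    Matrix (Site d × Fin N × σ) (Site d × Fin N × σ) ℂ :=
  Matrix.of fun p q =>
    if blockMap M q.1 = p.1 ∧ q.2.2 = p.2.2 then
      ((M : ℂ) ^ d)⁻¹ * ρ (blockCornerTransport M U q.1) p.2.1 q.2.1
    else 0

/-- The **conjugate block averaging operator** `Q̄(U)` acting on `ψ̄` (transport with the inverse
transporter, `(Q̄(U)ψ̄)(y) = M^{-d} Σ_{x ∈ B(y)} ψ̄(x) ρ(U(Γ_{My,x}))⁻¹`; Dimock 2022 §2 writes it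
`Q(-A)` in the abelian case), as a matrix with the fine index on the left:
`Q̄(U)_{(x,b,s'),(y,a,s)} = M^{-d} δ_{s s'} [⌊x/M⌋ = y] ρ(U(Γ_{My,x})⁻¹)_{ba}`. For unitary `ρ` this is
the conjugate transpose of `fermionBlockAvgZd`; the `ℤ^d` twin of the torus `fermionBlockAvgBar`.
[cite: BalabanOcarrollSchor1989, (1.1)] -/
def fermionBlockAvgBarZd (M : ℕ) (U : LGConfig d G) :
    Matrix (Site d × Fin N × σ) (Site d × Fin N × σ) ℂ :=
  Matrix.of fun q p =>
    if blockMap M q.1 = p.1 ∧ q.2.2 = p.2.2 then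
      ((M : ℂ) ^ d)⁻¹ * ρ (blockCornerTransport M U q.1)⁻¹ q.2.1 p.2.1
    else 0

/-- Without blocking (`M = 1`) the block average is the identity. [folklore] -/
theorem fermionBlockAvgZd_one_left (U : LGConfig d G) :
    fermionBlockAvgZd (σ := σ) ρ 1 U = 1 := by
  ext ⟨y, a, s⟩ ⟨x, b, s'⟩
  simp only [fermionBlockAvgZd, Matrix.of_apply, blockMap_one, blockCornerTransport_one_left, map_one,
    Nat.cast_one, one_pow, inv_one, one_mul, Matrix.one_apply, Prod.mk.injEq]
  by_cases hxy : x = y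
  · subst hxy
    by_cases hs : s' = s
    · subst hs
      by_cases hab : a = b
      · subst hab; simp
      · simp [hab]
    · simp [hs, Ne.symm hs]
  · simp [hxy, Ne.symm hxy]

/-- **Gauge covariance of the fermion block average** on each colour block:
`Q(U^g)_{(y,·,s),(x,·,s')} = ρ(g(My)) Q(U)_{(y,·,s),(x,·,s')} ρ(g(x))⁻¹`, so that
`Q(U^g) (ψ^g) = (Q(U)ψ)^{g ∘ blockBase M}` transforms with the coarse gauge transformation of
`axialBlockHolonomy_gaugeTransformZd` (Dimock 2022 §2; Bałaban CMP 95 (1984) (1.7)). [folklore] -/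
theorem fermionBlockAvgZd_gaugeTransformZd (M : ℕ) [NeZero M] (g : Site d → G) (U : LGConfig d G)
    (y x : Site d) (s s' : σ) :
    (Matrix.of fun a b => fermionBlockAvgZd (σ := σ) ρ M (gaugeTransformZd g U) (y, a, s) (x, b, s')) =
      ρ (g (blockBase M y)) * (Matrix.of fun a b => fermionBlockAvgZd (σ := σ) ρ M U (y, a, s) (x, b, s')) *
        ρ (g x)⁻¹ := by
  ext a b
  by_cases h : blockMap M x = y ∧ s' = s
  · obtain ⟨rfl, rfl⟩ := h
    simp only [fermionBlockAvgZd, Matrix.of_apply, and_self, if_true,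
      blockCornerTransport_gaugeTransformZd, map_mul, Matrix.mul_apply]
    simp only [Finset.mul_sum, Finset.sum_mul]
    refine Finset.sum_congr rfl fun c _ => Finset.sum_congr rfl fun c' _ => ?_
    ring
  · simp only [fermionBlockAvgZd, Matrix.of_apply, h, if_false, Matrix.mul_apply]
    simp

end Average

/-! ### Finite volumes: fine sites, site edges, ordered fermion indices -/

/-- The fine sites over the coarse site volume `Λ`: the union of the blocks `B(y)`, `y ∈ Λ`
(`M ^ d` sites each) (Bałaban CMP 95 (1984) §1). [folklore] -/
def fineSites (M : ℕ) (Λ : Finset (Site d)) : Finset (Site d) := Λ.biUnion (blockSites M)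

/-- `x` is a fine site over `Λ` iff its block label is in `Λ`. [folklore] -/
theorem mem_fineSites_iff (M : ℕ) [NeZero M] {Λ : Finset (Site d)} {x : Site d} :
    x ∈ fineSites M Λ ↔ blockMap M x ∈ Λ := by
  simp only [fineSites, mem_biUnion, mem_blockSites_iff]
  exact ⟨fun ⟨y, hy, hxy⟩ => hxy ▸ hy, fun h => ⟨_, h, rfl⟩⟩

/-- The positively oriented edges emanating from the site volume `Λ`: `Λ × {0, …, d-1}`. These
carry the gauge variables integrated in one block RG step over `Λ` (free boundary condition, as
in `BalabanRG.IsBlockRGStepOf`). [folklore] -/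
def siteEdges (Λ : Finset (Site d)) : Finset (ZdEdge d) := Λ ×ˢ Finset.univ

/-- Membership in `siteEdges`. [folklore] -/
@[simp] theorem mem_siteEdges_iff {Λ : Finset (Site d)} {e : ZdEdge d} : e ∈ siteEdges Λ ↔ e.1 ∈ Λ := by
  simp [siteEdges]

/-- Self-similarity of the volumes: the fine edges over the edges emanating from `Λ` are the edges
emanating from the fine sites over `Λ`. [folklore] -/
theorem fineEdges_siteEdges (M : ℕ) [NeZero M] (Λ : Finset (Site d)) :
    fineEdges M (siteEdges Λ) = siteEdges (fineSites M Λ) := by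
  ext e
  rw [mem_fineEdges_iff, mem_siteEdges_iff, mem_siteEdges_iff, mem_fineSites_iff]
  rfl

/-- The sites of the finite volume `Λ ⊂ ℤ^d` as a finite **linearly ordered** type (lexicographic
order of `ℤ^d`, Mathlib `Pi.Lex`), as needed to index Grassmann generators for Berezin
integration (`GrassmannIntegral.berezin`). [folklore] -/
abbrev VolSite (Λ : Finset (Site d)) : Type :=
  ↥(Λ.map (toLex : Site d ≃ Lex (Site d)).toEmbedding)

/-- The underlying site of an ordered volume site. [folklore] -/
def VolSite.site {Λ : Finset (Site d)} (x : VolSite Λ) : Site d := ofLex (x : Lex (Site d))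

/-- An ordered volume site lies in the volume. [folklore] -/
theorem VolSite.site_mem {Λ : Finset (Site d)} (x : VolSite Λ) : x.site ∈ Λ := by
  obtain ⟨x, hx⟩ := x
  obtain ⟨y, hy, rfl⟩ := Finset.mem_map.1 hx
  simpa [VolSite.site] using hy

/-- The ordered volume site of a site of `Λ`. [folklore] -/
def VolSite.mk {Λ : Finset (Site d)} (x : Site d) (hx : x ∈ Λ) : VolSite Λ :=
  ⟨toLex x, Finset.mem_map_of_mem _ hx⟩

/-- `VolSite.mk` and `VolSite.site` are inverse. [folklore] -/
@[simp] theorem VolSite.site_mk {Λ : Finset (Site d)} (x : Site d) (hx : x ∈ Λ) :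
    (VolSite.mk x hx).site = x := rfl

/-- The **fermion index** of the site volume `Λ`: `site × colour × internal` in lexicographic
order (internal index `σ` = spin × flavour), a finite linear order. [folklore] -/
abbrev FermiIdx (Λ : Finset (Site d)) (N : ℕ) (σ : Type*) [LinearOrder σ] : Type _ :=
  VolSite Λ ×ₗ (Fin N ×ₗ σ)

namespace FermiIdx

variable {Λ : Finset (Site d)} {σ : Type*} [LinearOrder σ]

/-- The `ℤ^d`-index `(site, colour, internal)` of a fermion index of the volume `Λ`. [folklore] -/
def toIdx (p : FermiIdx Λ N σ) : Site d × Fin N × σ :=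
  ((ofLex p).1.site, (ofLex (ofLex p).2).1, (ofLex (ofLex p).2).2)

/-- `toIdx` is injective. [folklore] -/
theorem toIdx_injective : Function.Injective (toIdx : FermiIdx Λ N σ → Site d × Fin N × σ) := by
  intro p q h
  simp only [toIdx, Prod.mk.injEq, VolSite.site, ofLex_inj] at h
  obtain ⟨h1, h2, h3⟩ := h
  apply ofLex.injective
  refine Prod.ext (Subtype.ext (by simpa using h1)) ?_
  apply ofLex.injective
  exact Prod.ext h2 h3

/-- The site of a fermion index lies in the volume. [folklore] -/
theorem toIdx_fst_mem (p : FermiIdx Λ N σ) : (toIdx p).1 ∈ Λ := (ofLex p).1.site_mem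

end FermiIdx

section AverageOn

variable [Group G] (ρ : G →* Matrix (Fin N) (Fin N) ℂ) {σ : Type*} [LinearOrder σ]

/-- The block averaging operator `Q(U)` from the fine volume `fineSites M Λ` to the coarse volume
`Λ`, as a finite matrix (restriction of `fermionBlockAvgZd`). [cite: BalabanOcarrollSchor1989, (1.1)] -/
def fermionBlockAvgOn (M : ℕ) (U : LGConfig d G) (Λ : Finset (Site d)) :
    Matrix (FermiIdx Λ N σ) (FermiIdx (fineSites M Λ) N σ) ℂ :=
  (fermionBlockAvgZd ρ M U).submatrix FermiIdx.toIdx FermiIdx.toIdx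

/-- The conjugate block averaging operator `Q̄(U)` between the same volumes (restriction of
`fermionBlockAvgBarZd`). [cite: BalabanOcarrollSchor1989, (1.1)] -/
def fermionBlockAvgBarOn (M : ℕ) (U : LGConfig d G) (Λ : Finset (Site d)) :
    Matrix (FermiIdx (fineSites M Λ) N σ) (FermiIdx Λ N σ) ℂ :=
  (fermionBlockAvgBarZd ρ M U).submatrix FermiIdx.toIdx FermiIdx.toIdx

end AverageOn


/-! ### Normalisation of the fermionic block RG transformation -/

section Norm

variable (R : Type*) [CommRing R] (κ : Type*) [Fintype κ]

/-- The inverse `N⁻¹ = ∫ exp(-a ⟨χ̄, χ⟩) dχ̄ dχ = ε (-a)^n` of the **normalisation constant** `N` of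
the fermionic block RG transformation (Bałaban–O'Carroll–Schor CMP 122 (1989) (1.2):
`∫ (T ρ) dχ̄ dχ = ∫ ρ dψ̄ dψ` for the normalised `N · T`; the tree's `fermionBlockRG` is
un-normalised), for `n = |κ|` block fermion modes, with the orientation sign `ε = (-1)^{n(n-1)/2}`
of `berezin_grassmannExp_quadratic` (`∫ dχ̄dχ e^{χ̄Aχ} = ε det A`, `A = -a·1`).
[cite: BalabanOcarrollSchor1989, (1.2)] -/
def blockRGNorm (a : R) : R :=
  (-1 : R) ^ (Fintype.card κ * (Fintype.card κ - 1) / 2) * (-a) ^ Fintype.card κ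

/-- With no block fermion modes the normalisation is `1`. [folklore] -/
theorem blockRGNorm_of_isEmpty [IsEmpty κ] (a : R) : blockRGNorm R κ a = 1 := by
  simp [blockRGNorm]

end Norm


/-! ### One block RG step for gauge fields coupled to fermions -/

section Step

open GrassmannAlgebra

variable [Group G] (ρ : G →* Matrix (Fin N) (Fin N) ℂ) (σ : Type*) [LinearOrder σ] [Fintype σ]

/-- The **fermion algebra of the site volume `Λ`**: the complex Grassmann algebra generated by
`ψ̄_{x,a,s}, ψ_{x,a,s}`, `(x, a, s) ∈ Λ × colour × internal`, indexed by `FermiIdx Λ N σ ⊕ₗ FermiIdx Λ N σ`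
(all `ψ̄` before all `ψ`, the convention of `GrassmannIntegral.psiBar`/`psi`). The effective
densities of the block RG are functions of the gauge field with values in this algebra
(Bałaban–O'Carroll–Schor CMP 122 (1989) §I; Dimock 2022 §1). [folklore] -/
abbrev FermiAlgebra (Λ : Finset (Site d)) : Type _ :=
  GrassmannAlgebra ℂ (FermiIdx Λ N σ ⊕ₗ FermiIdx Λ N σ)

variable {σ}

/-- The **block fermion RG transformation at fixed fine gauge field `U`**: BOS's `T_{a,Q(U)}`
(the tree's `fermionBlockRG` of `WilsonFermionBlockAveraging`) with the gauge-covariant block average `Q(U)` (`fermionBlockAvgOn`) and its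
conjugate `Q̄(U)` (`fermionBlockAvgBarOn`), from the fermion algebra of the fine volume
`fineSites M Λ` to that of the coarse volume `Λ`
(Bałaban–O'Carroll–Schor CMP 122 (1989) (1.1) "with a view to future applications to lattice
regularized … gauge-Fermionic models"; Dimock, J. Math. Phys. 63 (2022) §2 (4), the fermionic
factor of the coupled transformation). [cite: BalabanOcarrollSchor1989, (1.1)] -/
def blockFermionRGT (a : ℝ) (M : ℕ) (Λ : Finset (Site d)) (U : LGConfig d G) :
    FermiAlgebra (N := N) σ (fineSites M Λ) →ₗ[ℂ] FermiAlgebra (N := N) σ Λ :=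
  fermionBlockRG ℂ (a : ℂ) (fermionBlockAvgOn (σ := σ) ρ M U Λ) (fermionBlockAvgBarOn (σ := σ) ρ M U Λ)

/-- **The exact fermionic step inside the coupled transformation**: on a Gaussian fine density
`exp(-ψ̄ D ψ)` (e.g. the Wilson-fermion Boltzmann weight in the background `U`), the block fermion
RG transformation at fixed `U` gives the effective determinant times the block Gaussian,
`T_{a,Q(U)}(e^{-ψ̄Dψ}) = ε det(-(D + aQ̄(U)Q(U))) • e^{-χ̄ D₁ χ}` with the block Dirac operator
`D₁ = a - a² Q(U) (D + aQ̄(U)Q(U))⁻¹ Q̄(U)` (`blockDirac`) — an instance of the tree's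
`fermionBlockRG_grassmannExp_quadratic` (Bałaban–O'Carroll–Schor CMP 122 (1989) Lemma II.2–II.3;
Dimock 2022 §2). [cite: BalabanOcarrollSchor1989, Lemma II.2] -/
theorem blockFermionRGT_grassmannExp_quadratic (a : ℝ) (M : ℕ) (Λ : Finset (Site d)) (U : LGConfig d G)
    (D : Matrix (FermiIdx (fineSites M Λ) N σ) (FermiIdx (fineSites M Λ) N σ) ℂ)
    (hF : IsUnit (fluctuationOp (a : ℂ) (fermionBlockAvgOn (σ := σ) ρ M U Λ)
      (fermionBlockAvgBarOn (σ := σ) ρ M U Λ) D).det) :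
    blockFermionRGT ρ a M Λ U (grassmannExp (quadratic ℂ (-D))) =
      ((-1 : ℂ) ^ (Fintype.card (FermiIdx (fineSites M Λ) N σ) *
            (Fintype.card (FermiIdx (fineSites M Λ) N σ) - 1) / 2) *
          (-fluctuationOp (a : ℂ) (fermionBlockAvgOn (σ := σ) ρ M U Λ)
            (fermionBlockAvgBarOn (σ := σ) ρ M U Λ) D).det) •
        grassmannExp (quadratic ℂ (-blockDirac (a : ℂ) (fermionBlockAvgOn (σ := σ) ρ M U Λ)
          (fermionBlockAvgBarOn (σ := σ) ρ M U Λ) D)) :=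
  fermionBlockRG_grassmannExp_quadratic ℂ _ _ _ D hF

variable [MeasurableSpace G] [TopologicalSpace G] [IsTopologicalGroup G] [CompactSpace G]
  [BorelSpace G]

/-- `ρk1` is the **block RG transform of `ρk` for gauge fields coupled to fermions**, in the coarse
site volume `Λ` with block size `M` and BOS parameter `a` (free boundary condition): for every
Grassmann monomial `θ_s` of the coarse fermion algebra, the complex measure
`coeff_s(ρk1(V)) dV` on coarse gauge fields (`dV` = product Haar measure on the edges emanating
from `Λ`, `freeHaarConfig (siteEdges Λ)`) is the pushforward under Bałaban's block average
`V = Ū` (`axialBlockHolonomy M`) of `coeff_s(T_{a,Q(U)} ρk(U)) dU` (`dU` on the fine edges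
`fineEdges M (siteEdges Λ) = siteEdges (fineSites M Λ)`), i.e.
`ρk1(V, χ̄, χ) = ∫ δ(V⁻¹ Ū) [∫ exp(-a⟨χ̄ - Q̄(U)ψ̄, χ - Q(U)ψ⟩) ρk(U, ψ̄, ψ) dψ̄ dψ] dU`
— Dimock's coupled transformation (J. Math. Phys. 63 (2022) §2 (4),
`ρ̃₁(A₁, Ψ₁) = N ∫ DA₀ DΨ₀ δ(A₁ - QA₀) δ_ax(A₀) exp(-b/L⟨Ψ̄₁ - Q(-A₀)Ψ̄₀, Ψ₁ - Q(A₀)Ψ₀⟩) ρ₀(A₀, Ψ₀)`,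
abelian `d = 3`) written for a compact gauge group with Bałaban's gauge-field average (CMP 109
(1987) (0.1)–(0.2), pure gauge: `BalabanRG.IsBlockRGStepOf`) and BOS's fermion average (CMP 122
(1989) (1.1)). Coefficients enter through `Measure.withDensityᵥ` (junk `0` for non-integrable
coefficient functions) and `VectorMeasure.map`. [cite: Dimock2022QED3, §2 (4)] -/
def IsBlockFermionRGStepOf (a : ℝ) (M : ℕ) (Λ : Finset (Site d))
    (ρk : LGConfig d G → FermiAlgebra (N := N) σ (fineSites M Λ))
    (ρk1 : LGConfig d G → FermiAlgebra (N := N) σ Λ) : Prop :=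
  ∀ s : Finset (FermiIdx Λ N σ ⊕ₗ FermiIdx Λ N σ),
    ((freeHaarConfig (fineEdges M (siteEdges Λ))).withDensityᵥ fun U =>
        (grassmannBasis ℂ _).coord s (blockFermionRGT ρ a M Λ U (ρk U))).map (axialBlockHolonomy M) =
      (freeHaarConfig (G := G) (siteEdges Λ)).withDensityᵥ fun V => (grassmannBasis ℂ _).coord s (ρk1 V)

end Step

/-! ### Wilson–Dirac fermions on `ℤ^d` and the block RG scheme -/

section WilsonDirac

variable [Group G] (ρ : G →* Matrix (Fin N) (Fin N) ℂ) {s Nf : ℕ}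

/-- The gauge-covariant **Wilson–Dirac operator on `ℤ^d`** with `N_f` flavours (flavour-blind bare
mass `m`, Wilson parameter `r`), for a family `γ` of Euclidean Dirac matrices on `Fin s`, as an
infinite matrix on `site × colour × (spin ×ₗ flavour)`:
`(D_W)_{(x,a,α,f),(y,b,β,f')} = δ_{ff'} [(m + d r) δ - ½ Σ_μ ((r - γ_μ)_{αβ} ρ(U(x,μ))_{ab} δ_{y,x+μ̂}
 + (r + γ_μ)_{αβ} ρ(U(y,μ)⁻¹)_{ab} δ_{x,y+μ̂})]`
— the formula of the tree's torus operator `GrassmannIntegral.wilsonDirac` (`d = 4`,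
`γ = euclideanGamma`, one flavour) on the infinite lattice (Wilson 1975; Montvay–Münster §4.2.2
(4.85), §5.1.1 (5.5); Bałaban–O'Carroll–Schor CMP 122 (1989) (1.4) is the `r = 1` naive-plus-Wilson
form `ε⁻¹ Σ_μ (γ_μ ∇_μ - ½ Δ)` in lattice units). [cite: Wilson1975] -/
def wilsonDiracZd (γ : Fin d → Matrix (Fin s) (Fin s) ℂ) (U : LGConfig d G) (m r : ℝ) :
    Matrix (Site d × Fin N × (Fin s ×ₗ Fin Nf)) (Site d × Fin N × (Fin s ×ₗ Fin Nf)) ℂ :=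
  Matrix.of fun p q =>
    if (ofLex p.2.2).2 ≠ (ofLex q.2.2).2 then 0
    else
      (if p = q then ((m + d * r : ℝ) : ℂ) else 0) -
        (1 / 2 : ℂ) * ∑ μ : Fin d,
          ((if q.1 = p.1 + Pi.single μ 1 then
              ((r : ℂ) • (1 : Matrix (Fin s) (Fin s) ℂ) - γ μ) (ofLex p.2.2).1 (ofLex q.2.2).1 *
                ρ (U (p.1, μ)) p.2.1 q.2.1
            else 0) +
            (if p.1 = q.1 + Pi.single μ 1 then
              ((r : ℂ) • (1 : Matrix (Fin s) (Fin s) ℂ) + γ μ) (ofLex p.2.2).1 (ofLex q.2.2).1 *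
                ρ (U (q.1, μ))⁻¹ p.2.1 q.2.1
            else 0))

/-- The Wilson–Dirac operator **restricted to the finite site volume `Λ`** (free/Dirichlet
boundary condition: hops leaving `Λ` are dropped), as a matrix on the ordered fermion index
`FermiIdx Λ N (Fin s ×ₗ Fin Nf)`. [cite: Wilson1975] -/
def wilsonDiracOn (γ : Fin d → Matrix (Fin s) (Fin s) ℂ) (Λ : Finset (Site d)) (U : LGConfig d G)
    (m r : ℝ) : Matrix (FermiIdx Λ N (Fin s ×ₗ Fin Nf)) (FermiIdx Λ N (Fin s ×ₗ Fin Nf)) ℂ :=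
  (wilsonDiracZd (Nf := Nf) ρ γ U m r).submatrix FermiIdx.toIdx FermiIdx.toIdx

/-- The Wilson–Dirac operator is flavour-diagonal. [folklore] -/
theorem wilsonDiracZd_apply_of_ne (γ : Fin d → Matrix (Fin s) (Fin s) ℂ) (U : LGConfig d G) (m r : ℝ)
    {p q : Site d × Fin N × (Fin s ×ₗ Fin Nf)} (h : (ofLex p.2.2).2 ≠ (ofLex q.2.2).2) :
    wilsonDiracZd ρ γ U m r p q = 0 := by
  simp [wilsonDiracZd, h]

end WilsonDirac

section Scheme

open GrassmannAlgebra

/-- **Block renormalisation group scheme for lattice gauge fields coupled to Wilson–Dirac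
fermions** (a hypothesis structure in the format of the pure-gauge `BlockRGScheme`, STUB(v0) of
`BalabanRG`, extended by the fermionic step): gauge group `G` in the representation `ρ`, `N_f`
flavours of Wilson fermions with Dirac matrices `γ` on `Fin s`, flavour-blind bare mass. It bundles
the block size `M ≥ 2`, the BOS parameter `a > 0` of the exponential fermion weight, the Wilson
parameter `r > 0`, the running couplings `g_k` and running (flavour-blind) masses `m_k` with
`m_0 =` bare mass, the **effective densities** `density k Λ V` after `k` steps — functions of the
coarse gauge field with values in the fermion algebra of the coarse site volume `Λ` — starting from
`density 0 Λ U = exp(-g₀⁻² S_Λ(U)) · exp(-ψ̄ D_W(U; m₀, r) ψ)` (Wilson gauge weight on the edges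
emanating from `Λ` times the Wilson-fermion Boltzmann weight), and the **fermionic kernels**
`kernel k Λ V` (the quadratic form of the fermionic part of the effective action, `D_k` of BOS
(1.5), with `kernel 0 = D_W`). As in `BlockRGScheme`, the couplings, masses and kernels for `k ≥ 1`
are bookkeeping data of the scheme (their extraction from `density k` is a renormalisation
prescription not fixed here), and the RG recursion is not a field but the predicate
`BlockFermionRGScheme.SatisfiesRecursion` (so that it can be imposed as a hypothesis). Sources:
Bałaban–O'Carroll–Schor CMP 122 (1989) (1.1)–(1.5); Bałaban CMP 109 (1987) (0.1)–(0.3); Dimock,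
J. Math. Phys. 63 (2022) §2 (4)–(6) (the coupled flow `ρ₀, ρ₁, ρ₂, …` for QED₃).
[cite: BalabanOcarrollSchor1989, (1.1)–(1.5)] -/
structure BlockFermionRGScheme (d N : ℕ) (G : Type*) [Group G] [MeasurableSpace G] (s Nf : ℕ)
    (γ : Fin d → Matrix (Fin s) (Fin s) ℂ) where
  /-- The block size `M` (Bałaban's `L`). -/
  M : ℕ
  /-- Blocks are non-trivial: `2 ≤ M`. -/
  two_le_M : 2 ≤ M
  /-- The (unitary) representation in which the fermions and the Wilson action live. -/
  ρ : G →* Matrix (Fin N) (Fin N) ℂ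
  /-- The parameter `a > 0` of the exponential fermion weight (BOS (1.1)). -/
  a : ℝ
  /-- `a` is positive. -/
  a_pos : 0 < a
  /-- The Wilson parameter `r` (`r = 1` standard). -/
  r : ℝ
  /-- `r` is positive (no doublers). -/
  r_pos : 0 < r
  /-- The flavour-blind bare mass `m₀` (in lattice units). -/
  bareMass : ℝ
  /-- The running gauge couplings `g_k` (Bałaban CMP 109 (1987) (0.3)). -/
  couplings : RunningCouplings
  /-- The running flavour-blind fermion masses `m_k`. -/
  masses : ℕ → ℝ
  /-- The mass flow starts at the bare mass. -/
  masses_zero : masses 0 = bareMass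
  /-- The effective densities `ρ_k(Λ; V, χ̄, χ)` after `k` block RG steps, in the coarse site
  volume `Λ`, as functions of the coarse gauge field with values in the fermion algebra of `Λ`. -/
  density : ℕ → (Λ : Finset (Site d)) → LGConfig d G → FermiAlgebra (N := N) (Fin s ×ₗ Fin Nf) Λ
  /-- The starting density is the Wilson gauge weight times the Wilson-fermion Boltzmann weight:
  `ρ_0(Λ; U) = exp(-g₀⁻² S_{siteEdges Λ}(U)) • exp(ψ̄ (-D_W(U; m₀, r)) ψ)`. -/
  density_zero : ∀ (Λ : Finset (Site d)) (U : LGConfig d G),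
    density 0 Λ U =
      (Real.exp (-((couplings 0)⁻¹ ^ 2 * wilsonBoundaryAction ρ (siteEdges Λ) U)) : ℂ) •
        grassmannExp (quadratic ℂ (-wilsonDiracOn (Nf := Nf) ρ γ Λ U bareMass r))
  /-- The fermionic kernels `D_k(Λ; V)`: the quadratic form of the fermionic part of the effective
  action after `k` steps (BOS (1.5)). -/
  kernel : ℕ → (Λ : Finset (Site d)) → LGConfig d G →
    Matrix (FermiIdx Λ N (Fin s ×ₗ Fin Nf)) (FermiIdx Λ N (Fin s ×ₗ Fin Nf)) ℂ
  /-- The kernel flow starts at the Wilson–Dirac operator. -/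
  kernel_zero : ∀ (Λ : Finset (Site d)) (U : LGConfig d G),
    kernel 0 Λ U = wilsonDiracOn (Nf := Nf) ρ γ Λ U bareMass r

namespace BlockFermionRGScheme

variable [Group G] [MeasurableSpace G] {s Nf : ℕ} {γ : Fin d → Matrix (Fin s) (Fin s) ℂ}
  (sch : BlockFermionRGScheme d N G s Nf γ)

/-- The block size of a scheme is non-zero. [folklore] -/
instance neZero_M : NeZero sch.M := ⟨by have := sch.two_le_M; omega⟩

/-- The fermionic block-averaging data (block size, Gaussian parameter) of the scheme, in the format
of the tree's `WilsonFermionBlockAveraging` (whose namespace provides the fixed-background block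
Dirac operator, propagator and determinant factor on tori). [folklore] -/
def toWilsonFermionBlockAveraging : WilsonFermionBlockAveraging where
  M := sch.M
  two_le_M := sch.two_le_M
  a := sch.a
  a_pos := sch.a_pos

/-- The scheme **satisfies the block RG recursion**: for every step `k` and every coarse site
volume `Λ`, `density (k+1) Λ` is the coupled block RG transform (`IsBlockFermionRGStepOf`) of
`density k` on the fine volume `fineSites M Λ` (Dimock 2022 §2 (5)–(6): "one can repeat the
transformation generating a sequence `ρ₀, ρ₁, ρ₂, …`"; Bałaban CMP 109 (1987) (0.1)–(0.2)).
[cite: Dimock2022QED3, §2 (5)–(6)] -/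
def SatisfiesRecursion [TopologicalSpace G] [IsTopologicalGroup G] [CompactSpace G] [BorelSpace G] : Prop :=
  ∀ (k : ℕ) (Λ : Finset (Site d)),
    IsBlockFermionRGStepOf sch.ρ sch.a sch.M Λ (sch.density k (fineSites sch.M Λ)) (sch.density (k + 1) Λ)

/-- The couplings of the scheme stay in the window `(0, γ]` at every step ("bounded coupling
flow", the shape of the hypotheses of Bałaban CMP 122 (1989) Thm. 1 and of the uses of this
scheme). [folklore] -/
def HasBoundedFlow (γw : ℝ) : Prop :=
  ∀ k, InWindow sch.couplings γw k

/-- Unfolding `HasBoundedFlow`: every coupling is in `(0, γ]`. [folklore] -/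
theorem hasBoundedFlow_iff (γw : ℝ) : sch.HasBoundedFlow γw ↔ ∀ k, 0 < sch.couplings k ∧ sch.couplings k ≤ γw :=
  ⟨fun h k => h k k le_rfl, fun h _ j _ => h j⟩

/-- The starting density of the trivial gauge field is the free Wilson-fermion Boltzmann weight
(the Wilson action of `U = 1` vanishes). [folklore] -/
theorem density_zero_one (Λ : Finset (Site d)) :
    sch.density 0 Λ 1 =
      grassmannExp (quadratic ℂ (-wilsonDiracOn (Nf := Nf) sch.ρ γ Λ 1 sch.bareMass sch.r)) := by
  rw [sch.density_zero]
  have : wilsonBoundaryAction sch.ρ (siteEdges Λ) (1 : LGConfig d G) = 0 := by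
    refine sum_eq_zero fun p _ => ?_
    simp [plaquetteObs, plaquetteHolonomyZd, Matrix.trace_one, Fintype.card_fin]
  simp [this]

end BlockFermionRGScheme

end Scheme


/-! ### More on the conjugate block average -/

section AverageBar

variable [Group G] (ρ : G →* Matrix (Fin N) (Fin N) ℂ) {σ : Type*} [DecidableEq σ]

/-- Without blocking (`M = 1`) the conjugate block average is the identity. [folklore] -/
theorem fermionBlockAvgBarZd_one_left (U : LGConfig d G) :
    fermionBlockAvgBarZd (σ := σ) ρ 1 U = 1 := by
  ext ⟨x, b, s'⟩ ⟨y, a, s⟩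
  simp only [fermionBlockAvgBarZd, Matrix.of_apply, blockMap_one, blockCornerTransport_one_left,
    inv_one, map_one, Nat.cast_one, one_pow, one_mul, Matrix.one_apply, Prod.mk.injEq]
  by_cases hxy : x = y
  · subst hxy
    by_cases hs : s' = s
    · subst hs
      by_cases hab : b = a
      · subst hab; simp
      · simp [hab]
    · simp [hs]
  · simp [hxy]

/-- **Gauge covariance of the conjugate fermion block average** on each colour block:
`Q̄(U^g)_{(x,·,s'),(y,·,s)} = ρ(g(x)) Q̄(U)_{(x,·,s'),(y,·,s)} ρ(g(My))⁻¹` (Dimock 2022 §2, `Q(-A)`;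
Bałaban CMP 95 (1984) (1.7)). [folklore] -/
theorem fermionBlockAvgBarZd_gaugeTransformZd (M : ℕ) [NeZero M] (g : Site d → G) (U : LGConfig d G)
    (x y : Site d) (s' s : σ) :
    (Matrix.of fun b a => fermionBlockAvgBarZd (σ := σ) ρ M (gaugeTransformZd g U) (x, b, s') (y, a, s)) =
      ρ (g x) * (Matrix.of fun b a => fermionBlockAvgBarZd (σ := σ) ρ M U (x, b, s') (y, a, s)) *
        ρ (g (blockBase M y))⁻¹ := by
  ext b a
  by_cases h : blockMap M x = y ∧ s' = s
  · obtain ⟨rfl, rfl⟩ := h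
    simp only [fermionBlockAvgBarZd, Matrix.of_apply, and_self, if_true,
      blockCornerTransport_gaugeTransformZd, _root_.mul_inv_rev, inv_inv, map_mul, Matrix.mul_apply]
    simp only [Finset.mul_sum, Finset.sum_mul]
    refine Finset.sum_comm.trans (Finset.sum_congr rfl fun c _ => Finset.sum_congr rfl fun c' _ => ?_)
    ring
  · simp only [fermionBlockAvgBarZd, Matrix.of_apply, h, if_false, Matrix.mul_apply]
    simp

end AverageBar

/-! ### The normalisation identity (1.2) of Bałaban–O'Carroll–Schor -/

section NormProof

open GrassmannAlgebra ExteriorAlgebra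

variable (R : Type*) [CommRing R] {n m : Type*} [LinearOrder n] [LinearOrder m]

/-- Every generator index of the joint algebra of one block RG step is a block index (`inlLex`) or
a fine index (`inrLex`). [folklore] -/
theorem eq_inlLex_or_eq_inrLex (j : BlockRGIdx n m) :
    (∃ k, j = inlLex (n ⊕ₗ n) (m ⊕ₗ m) k) ∨ ∃ k, j = inrLex (n ⊕ₗ n) (m ⊕ₗ m) k := by
  cases h : ofLex j with
  | inl k => exact Or.inl ⟨k, by rw [← toLex_ofLex j, h]; rfl⟩
  | inr k => exact Or.inr ⟨k, by rw [← toLex_ofLex j, h]; rfl⟩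

/-- Block indices precede fine indices in the joint algebra. [folklore] -/
theorem inlLex_lt_inrLex (j : n ⊕ₗ n) (k : m ⊕ₗ m) :
    inlLex (n ⊕ₗ n) (m ⊕ₗ m) j < inrLex (n ⊕ₗ n) (m ⊕ₗ m) k :=
  Sum.Lex.inl_lt_inr j k

variable [Fintype n] [Fintype m]

/-- **Spectators of the fine block come from the block-fermion algebra**: an element of the joint
algebra involving no fine generator is the image of an element of `Λ(χ̄, χ)` under the embedding
along `inlLex`. [folklore] -/
theorem exists_map_inlLex_eq_of_mem_spectatorSubalgebra {z : GrassmannAlgebra R (BlockRGIdx n m)}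
    (hz : z ∈ spectatorSubalgebra R (Finset.univ.map (inrLex (n ⊕ₗ n) (m ⊕ₗ m)).toEmbedding)) :
    ∃ w : GrassmannAlgebra R (n ⊕ₗ n),
      ExteriorAlgebra.map (Function.ExtendByZero.linearMap R (inlLex (n ⊕ₗ n) (m ⊕ₗ m))) w = z := by
  suffices h : Submodule.span R (grassmannBasis R (BlockRGIdx n m) ''
      {u | Disjoint u (Finset.univ.map (inrLex (n ⊕ₗ n) (m ⊕ₗ m)).toEmbedding)}) ≤
      LinearMap.range (ExteriorAlgebra.map
        (Function.ExtendByZero.linearMap R (inlLex (n ⊕ₗ n) (m ⊕ₗ m)))).toLinearMap by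
    obtain ⟨w, hw⟩ := LinearMap.mem_range.1 (h (mem_spectatorSubalgebra_iff.1 hz))
    exact ⟨w, hw⟩
  refine Submodule.span_le.2 ?_
  rintro _ ⟨u, hu, rfl⟩
  -- `u` avoids the fine block, hence is the image of a finset of block indices
  have htu : (Finset.univ.filter fun k => inlLex (n ⊕ₗ n) (m ⊕ₗ m) k ∈ u).map
      (inlLex (n ⊕ₗ n) (m ⊕ₗ m)).toEmbedding = u := by
    ext j
    simp only [Finset.mem_map, Finset.mem_filter, Finset.mem_univ, true_and,
      RelEmbedding.coe_toEmbedding]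
    constructor
    · rintro ⟨k, hk, rfl⟩; exact hk
    · intro hj
      rcases eq_inlLex_or_eq_inrLex j with ⟨k, rfl⟩ | ⟨k, rfl⟩
      · exact ⟨k, hj, rfl⟩
      · exact absurd (Finset.mem_map.2 ⟨k, Finset.mem_univ k, rfl⟩) (Finset.disjoint_left.1 hu hj)
  refine LinearMap.mem_range.2
    ⟨grassmannBasis R (n ⊕ₗ n) (Finset.univ.filter fun k => inlLex (n ⊕ₗ n) (m ⊕ₗ m) k ∈ u), ?_⟩
  rw [AlgHom.toLinearMap_apply, map_extendByZero_grassmannBasis, htu]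

omit [Fintype m] in
/-- The block Gaussian `-a Σ_y χ̄_y χ_y` embedded in the joint algebra. [folklore] -/
theorem map_inlLex_quadratic_neg_smul_one (a : R) :
    ExteriorAlgebra.map (Function.ExtendByZero.linearMap R (inlLex (n ⊕ₗ n) (m ⊕ₗ m)))
        (quadratic R (-(a • (1 : Matrix n n R)))) = -(a • ∑ y, chiBar (R := R) (m := m) y * chi y) := by
  rw [map_inlLex_quadratic]
  simp only [Matrix.neg_apply, Matrix.smul_apply, Matrix.one_apply, smul_eq_mul, mul_ite, mul_one,
    mul_zero, neg_smul, ite_smul, zero_smul, Finset.sum_neg_distrib, Finset.smul_sum]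
  congr 1
  refine Finset.sum_congr rfl fun y _ => ?_
  rw [Finset.sum_ite_eq, if_pos (Finset.mem_univ y)]

/-- The block-spin exponent `-a Σ_y (χ̄_y - (ψ̄Q̄)_y)(χ_y - (Qψ)_y)` is central (a sum of products of
two degree-one elements). [folklore] -/
theorem commute_blockRGExponent (a : R) (Q : Matrix n m R) (Qb : Matrix m n R)
    (z : GrassmannAlgebra R (BlockRGIdx n m)) : Commute (blockRGExponent R a Q Qb) z := by
  rw [blockRGExponent]
  refine Commute.neg_left (Commute.smul_left (Commute.sum_left _ _ _ fun y _ => ?_) a)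
  have h1 : chiBar (R := R) (m := m) y - ∑ x, Qb x y • psiBarF x =
      ExteriorAlgebra.ι R (Pi.single (inlLex (n ⊕ₗ n) (m ⊕ₗ m) (toLex (Sum.inl y))) 1 -
        ∑ x, Qb x y • Pi.single (inrLex (n ⊕ₗ n) (m ⊕ₗ m) (toLex (Sum.inl x))) 1) := by
    simp only [map_sub, map_sum, map_smul, chiBar, psiBarF, gen]
  have h2 : chi (R := R) (m := m) y - ∑ x, Q y x • psiF x =
      ExteriorAlgebra.ι R (Pi.single (inlLex (n ⊕ₗ n) (m ⊕ₗ m) (toLex (Sum.inr y))) 1 -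
        ∑ x, Q y x • Pi.single (inrLex (n ⊕ₗ n) (m ⊕ₗ m) (toLex (Sum.inr x))) 1) := by
    simp only [map_sub, map_sum, map_smul, chi, psiF, gen]
  rw [h1, h2]
  exact commute_ι_mul_ι _ _ z

variable [Algebra ℚ R]

/-- **The normalisation identity of the fermionic block RG transformation**
(Bałaban–O'Carroll–Schor, CMP 122 (1989), (1.2): "`N` is a normalization constant … such that
`∫ ρ'(χ̄, χ) dχ̄ dχ = ∫ ρ(ψ̄, ψ) dψ̄ dψ`"): for the un-normalised transformation of the tree,
`∫ (T_{a,Q} ρ) dχ̄ dχ = N⁻¹ ∫ ρ dψ̄ dψ` with `N⁻¹ = ε (-a)^{|n|} = blockRGNorm R n a`, for EVERY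
density `ρ` and every averaging pair `Q, Q̄` (not only `QQ̄ = 1`). Proof (loc. cit. p. 237, "the
translation formula `∫ f(φ + X, φ̄ + X̄) dφ dφ̄ = ∫ f(φ, φ̄) dφ dφ̄`"): by Fubini
(`berezinOn_berezinOn`; the block of `2|n|` generators commutes past the fine block without sign)
integrate the block fermions first; the weight `e^{-a⟨χ̄ - Q̄ψ̄, χ - Qψ⟩}` is the image of `e^{-a⟨χ̄, χ⟩}`
under the spectator shift `χ̄ ↦ χ̄ - Q̄ψ̄`, `χ ↦ χ - Qψ` (`IsSpectatorShift.berezinOn_map`), whose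
block integral is `ε det(-a·1)` (`berezin_grassmannExp_quadratic`). [cite: BalabanOcarrollSchor1989, (1.2)] -/
theorem berezin_fermionBlockRG (a : R) (Q : Matrix n m R) (Qb : Matrix m n R)
    (ρ : GrassmannAlgebra R (m ⊕ₗ m)) :
    berezin R (n ⊕ₗ n) (fermionBlockRG R a Q Qb ρ) = blockRGNorm R n a * berezin R (m ⊕ₗ m) ρ := by
  -- ordering facts
  have hCF : ∀ x ∈ (Finset.univ.map (inlLex (n ⊕ₗ n) (m ⊕ₗ m)).toEmbedding : Finset (BlockRGIdx n m)),
      ∀ y ∈ (Finset.univ.map (inrLex (n ⊕ₗ n) (m ⊕ₗ m)).toEmbedding : Finset (BlockRGIdx n m)),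
        x < y := by
    intro x hx y hy
    obtain ⟨j, -, rfl⟩ := Finset.mem_map.1 hx
    obtain ⟨k, -, rfl⟩ := Finset.mem_map.1 hy
    exact inlLex_lt_inrLex j k
  have hdisj : Disjoint (Finset.univ.map (inrLex (n ⊕ₗ n) (m ⊕ₗ m)).toEmbedding : Finset (BlockRGIdx n m))
      (Finset.univ.map (inlLex (n ⊕ₗ n) (m ⊕ₗ m)).toEmbedding) :=
    Finset.disjoint_left.2 fun x hxF hxC => lt_irrefl x (hCF x hxC x hxF)
  -- the spectator shift `χ̄_y ↦ χ̄_y - Σ_x Q̄_{xy} ψ̄_x`, `χ_y ↦ χ_y - Σ_x Q_{yx} ψ_x`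
  set vb : n → BlockRGIdx n m → R := fun y =>
    -∑ x : m, Qb x y • (Pi.single (inrLex (n ⊕ₗ n) (m ⊕ₗ m) (toLex (Sum.inl x))) (1 : R) :
      BlockRGIdx n m → R) with hvb
  set v : n → BlockRGIdx n m → R := fun y =>
    -∑ x : m, Q y x • (Pi.single (inrLex (n ⊕ₗ n) (m ⊕ₗ m) (toLex (Sum.inr x))) (1 : R) :
      BlockRGIdx n m → R) with hv
  set N : Module.End R (BlockRGIdx n m → R) := ∑ y : n,
    ((LinearMap.proj (inlLex (n ⊕ₗ n) (m ⊕ₗ m) (toLex (Sum.inl y))) :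
          (BlockRGIdx n m → R) →ₗ[R] R).smulRight (vb y) +
      (LinearMap.proj (inlLex (n ⊕ₗ n) (m ⊕ₗ m) (toLex (Sum.inr y))) :
          (BlockRGIdx n m → R) →ₗ[R] R).smulRight (v y)) with hN
  have hNapply : ∀ w, N w = ∑ y : n, (w (inlLex (n ⊕ₗ n) (m ⊕ₗ m) (toLex (Sum.inl y))) • vb y +
      w (inlLex (n ⊕ₗ n) (m ⊕ₗ m) (toLex (Sum.inr y))) • v y) := fun w => by
    simp only [hN, LinearMap.sum_apply, LinearMap.add_apply, LinearMap.smulRight_apply,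
      LinearMap.proj_apply]
  have hvbι : ∀ y, ExteriorAlgebra.ι R (vb y) = -∑ x, Qb x y • psiBarF (n := n) x := fun y => by
    simp only [hvb, map_neg, map_sum, map_smul, psiBarF, gen]
  have hvι : ∀ y, ExteriorAlgebra.ι R (v y) = -∑ x, Q y x • psiF (n := n) x := fun y => by
    simp only [hv, map_neg, map_sum, map_smul, psiF, gen]
  have hvbC : ∀ y k, vb y (inlLex (n ⊕ₗ n) (m ⊕ₗ m) k) = 0 := fun y k => by
    simp only [hvb, Pi.neg_apply, Finset.sum_apply, Pi.smul_apply, Pi.single_apply,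
      inlLex_ne_inrLex k, if_false, smul_zero, Finset.sum_const_zero, neg_zero]
  have hvC : ∀ y k, v y (inlLex (n ⊕ₗ n) (m ⊕ₗ m) k) = 0 := fun y k => by
    simp only [hv, Pi.neg_apply, Finset.sum_apply, Pi.smul_apply, Pi.single_apply,
      inlLex_ne_inrLex k, if_false, smul_zero, Finset.sum_const_zero, neg_zero]
  have hNshift : IsSpectatorShift R (Finset.univ.map (inlLex (n ⊕ₗ n) (m ⊕ₗ m)).toEmbedding) N := by
    refine ⟨fun j hj => ?_, fun j i hi => ?_⟩
    · rcases eq_inlLex_or_eq_inrLex j with ⟨k, rfl⟩ | ⟨k, rfl⟩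
      · exact absurd (Finset.mem_map.2 ⟨k, Finset.mem_univ k, rfl⟩) hj
      · rw [hNapply]
        refine Finset.sum_eq_zero fun y _ => ?_
        rw [Pi.single_eq_of_ne (inlLex_ne_inrLex _ k), Pi.single_eq_of_ne (inlLex_ne_inrLex _ k),
          zero_smul, zero_smul, add_zero]
    · obtain ⟨k, -, rfl⟩ := Finset.mem_map.1 hi
      change N (Pi.single j 1) (inlLex (n ⊕ₗ n) (m ⊕ₗ m) k) = 0
      rw [hNapply, Finset.sum_apply]
      refine Finset.sum_eq_zero fun y _ => ?_
      rw [Pi.add_apply, Pi.smul_apply, Pi.smul_apply, hvbC, hvC, smul_zero, smul_zero, add_zero]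
  have hNbar : ∀ y, N (Pi.single (inlLex (n ⊕ₗ n) (m ⊕ₗ m) (toLex (Sum.inl y))) 1) = vb y := by
    intro y
    rw [hNapply]
    have h1 : ∀ y', (Pi.single (inlLex (n ⊕ₗ n) (m ⊕ₗ m) (toLex (Sum.inl y))) (1 : R) :
        BlockRGIdx n m → R) (inlLex (n ⊕ₗ n) (m ⊕ₗ m) (toLex (Sum.inl y'))) =
        if y' = y then 1 else 0 := fun y' => by
      simp only [Pi.single_apply, EmbeddingLike.apply_eq_iff_eq, Sum.inl.injEq]
    have h2 : ∀ y', (Pi.single (inlLex (n ⊕ₗ n) (m ⊕ₗ m) (toLex (Sum.inl y))) (1 : R) :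
        BlockRGIdx n m → R) (inlLex (n ⊕ₗ n) (m ⊕ₗ m) (toLex (Sum.inr y'))) = 0 := fun y' => by
      simp
    simp only [h1, h2, zero_smul, add_zero, ite_smul, one_smul, Finset.sum_ite_eq', Finset.mem_univ,
      if_true]
  have hNchi : ∀ y, N (Pi.single (inlLex (n ⊕ₗ n) (m ⊕ₗ m) (toLex (Sum.inr y))) 1) = v y := by
    intro y
    rw [hNapply]
    have h1 : ∀ y', (Pi.single (inlLex (n ⊕ₗ n) (m ⊕ₗ m) (toLex (Sum.inr y))) (1 : R) :
        BlockRGIdx n m → R) (inlLex (n ⊕ₗ n) (m ⊕ₗ m) (toLex (Sum.inr y'))) =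
        if y' = y then 1 else 0 := fun y' => by
      simp only [Pi.single_apply, EmbeddingLike.apply_eq_iff_eq, Sum.inr.injEq]
    have h2 : ∀ y', (Pi.single (inlLex (n ⊕ₗ n) (m ⊕ₗ m) (toLex (Sum.inr y))) (1 : R) :
        BlockRGIdx n m → R) (inlLex (n ⊕ₗ n) (m ⊕ₗ m) (toLex (Sum.inl y'))) = 0 := fun y' => by
      simp
    simp only [h1, h2, zero_smul, zero_add, ite_smul, one_smul, Finset.sum_ite_eq', Finset.mem_univ,
      if_true]
  -- the exponent is the shifted block Gaussian
  have hexp : blockRGExponent R a Q Qb = ExteriorAlgebra.map (1 + N)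
      (ExteriorAlgebra.map (Function.ExtendByZero.linearMap R (inlLex (n ⊕ₗ n) (m ⊕ₗ m)))
        (quadratic R (-(a • (1 : Matrix n n R))))) := by
    have hb : ∀ y, ExteriorAlgebra.map (1 + N) (chiBar (R := R) (m := m) y) =
        chiBar y - ∑ x, Qb x y • psiBarF x := fun y => by
      rw [chiBar, map_one_add_gen, hNbar, hvbι, sub_eq_add_neg]
    have hc : ∀ y, ExteriorAlgebra.map (1 + N) (chi (R := R) (m := m) y) =
        chi y - ∑ x, Q y x • psiF x := fun y => by
      rw [chi, map_one_add_gen, hNchi, hvι, sub_eq_add_neg]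
    rw [map_inlLex_quadratic_neg_smul_one, map_neg, map_smul, map_sum]
    simp only [map_mul, hb, hc, blockRGExponent]
  -- the weight is the shifted block Gaussian, and is central
  have hX₀nil : IsNilpotent (ExteriorAlgebra.map (Function.ExtendByZero.linearMap R (inlLex (n ⊕ₗ n) (m ⊕ₗ m)))
      (quadratic R (-(a • (1 : Matrix n n R))))) := (isNilpotent_quadratic R _).map _
  have hWexp : blockRGWeight R a Q Qb = ExteriorAlgebra.map (1 + N)
      (ExteriorAlgebra.map (Function.ExtendByZero.linearMap R (inlLex (n ⊕ₗ n) (m ⊕ₗ m)))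
        (grassmannExp (quadratic R (-(a • (1 : Matrix n n R)))))) := by
    rw [blockRGWeight, hexp, grassmannExp, grassmannExp,
      IsNilpotent.map_exp (isNilpotent_quadratic R _), IsNilpotent.map_exp hX₀nil]
  have hEnil : IsNilpotent (blockRGExponent R a Q Qb) := by
    rw [hexp]; exact hX₀nil.map _
  have hWcomm : ∀ z, Commute (blockRGWeight R a Q Qb) z :=
    commute_exp_of_forall_commute (commute_blockRGExponent R a Q Qb) hEnil
  -- Step 1: the block integral of the weight is the normalisation constant
  have hA : berezin R (n ⊕ₗ n) (grassmannExp (quadratic R (-(a • (1 : Matrix n n R))))) =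
      blockRGNorm R n a := by
    rw [berezin_grassmannExp_quadratic_holds R, blockRGNorm, Matrix.det_neg, Matrix.det_smul,
      Matrix.det_one, mul_one, neg_pow a]
  have h1 : berezinOn R (Finset.univ.map (inlLex (n ⊕ₗ n) (m ⊕ₗ m)).toEmbedding) (blockRGWeight R a Q Qb) =
      algebraMap R _ (blockRGNorm R n a) := by
    rw [hWexp, hNshift.berezinOn_map, berezinOn_map_extendByZero, hA]
  -- Step 2: the block integral of `W · ρ`
  have hρspec : ExteriorAlgebra.map (Function.ExtendByZero.linearMap R (inrLex (n ⊕ₗ n) (m ⊕ₗ m))) ρ ∈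
      spectatorSubalgebra R (Finset.univ.map (inlLex (n ⊕ₗ n) (m ⊕ₗ m)).toEmbedding) :=
    map_extendByZero_mem_spectatorSubalgebra R (inrLex (n ⊕ₗ n) (m ⊕ₗ m)) (fun k hk => by
      obtain ⟨j, -, hj⟩ := Finset.mem_map.1 hk
      exact inlLex_ne_inrLex j k hj) ρ
  have h2 : berezinOn R (Finset.univ.map (inlLex (n ⊕ₗ n) (m ⊕ₗ m)).toEmbedding)
      (blockRGWeight R a Q Qb *
        ExteriorAlgebra.map (Function.ExtendByZero.linearMap R (inrLex (n ⊕ₗ n) (m ⊕ₗ m))) ρ) =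
      blockRGNorm R n a •
        ExteriorAlgebra.map (Function.ExtendByZero.linearMap R (inrLex (n ⊕ₗ n) (m ⊕ₗ m))) ρ := by
    rw [(hWcomm _).eq, berezinOn_mul_of_mem_spectatorSubalgebra R hρspec, h1, ← Algebra.commutes,
      ← Algebra.smul_def]
  -- Step 3: the iterated integral in both orders (no sign: the block has `2|n|` generators)
  have hsign : (((berezinSign (Finset.univ.map (inlLex (n ⊕ₗ n) (m ⊕ₗ m)).toEmbedding : Finset (BlockRGIdx n m))
      (Finset.univ.map (inrLex (n ⊕ₗ n) (m ⊕ₗ m)).toEmbedding ∪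
        Finset.univ.map (inlLex (n ⊕ₗ n) (m ⊕ₗ m)).toEmbedding) : ℤˣ) : ℤ) : R) = 1 := by
    rw [intCast_berezinSign, Finset.union_sdiff_cancel_right hdisj,
      Finset.filter_true_of_mem (fun p hp => ?_), Finset.card_product, Finset.card_map,
      Finset.card_map, Finset.card_univ, Finset.card_univ, Fintype.card_lex, Fintype.card_sum]
    · exact Even.neg_one_pow ⟨Fintype.card n * Fintype.card (m ⊕ₗ m), by ring⟩
    · obtain ⟨hx, hy⟩ := Finset.mem_product.1 hp
      exact hCF _ hx _ hy
  have hfull : berezinOn R (Finset.univ.map (inlLex (n ⊕ₗ n) (m ⊕ₗ m)).toEmbedding)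
      (berezinOn R (Finset.univ.map (inrLex (n ⊕ₗ n) (m ⊕ₗ m)).toEmbedding)
        (blockRGWeight R a Q Qb *
          ExteriorAlgebra.map (Function.ExtendByZero.linearMap R (inrLex (n ⊕ₗ n) (m ⊕ₗ m))) ρ)) =
      algebraMap R _ (blockRGNorm R n a * berezin R (m ⊕ₗ m) ρ) := by
    rw [berezinOn_berezinOn_of_forall_lt R hCF, Finset.union_comm,
      ← one_smul R (berezinOn R (Finset.univ.map (inrLex (n ⊕ₗ n) (m ⊕ₗ m)).toEmbedding ∪
        Finset.univ.map (inlLex (n ⊕ₗ n) (m ⊕ₗ m)).toEmbedding) _),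
      ← hsign, ← berezinOn_berezinOn R hdisj, h2, map_smul, berezinOn_map_extendByZero, Algebra.smul_def,
      ← map_mul]
  -- Step 4: read off in the block-fermion algebra
  obtain ⟨w, hw⟩ := exists_map_inlLex_eq_of_mem_spectatorSubalgebra R
    (berezinOn_mem_spectatorSubalgebra_self R (Finset.univ.map (inrLex (n ⊕ₗ n) (m ⊕ₗ m)).toEmbedding)
      (blockRGWeight R a Q Qb *
        ExteriorAlgebra.map (Function.ExtendByZero.linearMap R (inrLex (n ⊕ₗ n) (m ⊕ₗ m))) ρ))
  have hT : fermionBlockRG R a Q Qb ρ = w := by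
    rw [fermionBlockRG_apply, ← hw, map_funLeft_map_extendByZero_inlLex]
  have hw' : algebraMap R (GrassmannAlgebra R (BlockRGIdx n m)) (berezin R (n ⊕ₗ n) w) =
      algebraMap R _ (blockRGNorm R n a * berezin R (m ⊕ₗ m) ρ) := by
    rw [← hfull, ← hw, berezinOn_map_extendByZero]
  rw [hT]
  exact (ExteriorAlgebra.algebraMap_inj _ _ _).1 hw'

/-- BOS (1.2) for the **normalised** transformation `N · T_{a,Q}`: if `N⁻¹ = ε(-a)^{|n|}` is a unit
(e.g. `a ≠ 0` in a field), then `∫ (N · T ρ) dχ̄ dχ = ∫ ρ dψ̄ dψ`. [cite: BalabanOcarrollSchor1989, (1.2)] -/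
theorem berezin_inverse_blockRGNorm_smul_fermionBlockRG (a : R) (ha : IsUnit (blockRGNorm R n a))
    (Q : Matrix n m R) (Qb : Matrix m n R) (ρ : GrassmannAlgebra R (m ⊕ₗ m)) :
    berezin R (n ⊕ₗ n) (Ring.inverse (blockRGNorm R n a) • fermionBlockRG R a Q Qb ρ) =
      berezin R (m ⊕ₗ m) ρ := by
  rw [map_smul, berezin_fermionBlockRG, smul_eq_mul, ← mul_assoc, Ring.inverse_mul_cancel _ ha, one_mul]

end NormProof

end Literature.MathematicalPhysics.QuantumLattice
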